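import Mathlib
import HarnessLib
import Literature.MathematicalPhysics.QuantumLattice.ScaleZeroMultiplierFibre
import Literature.MathematicalPhysics.QuantumLattice.HubbardSymbolCentredComposition
import Literature.MathematicalPhysics.QuantumLattice.HubbardUVGridPieceMomentOrders

/-!
# The telescoping PIECES of the scale-`0` sector MULTIPLIER `χ₂(ω, b(c⃗))·Ã(c⃗)` sampled at centred momenta: fibrewise bounds of the
# bare piece and of a band increment, and their first SPACE moments, uniform in `M`, `β`, `L`

Topic `MathematicalPhysics/QuantumLattice`; the multiplier twin of `HubbardUVBandPieces` (k3c2-p1: the same for the ultraviolet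
covariance symbol `Ψ`, periodic sampling, no angular factor).  Inputs: `ScaleZeroMultiplierFibre` (fibrewise envelopes of the
complexified cutoff `M_ℂ = (bgmCutoff₂ e₀ · : ℂ)`, of `∂_v M_ℂ`, of `M_ℂ(·+δe₀) − M_ℂ` and of `∂_v` of it, `Λ = 2e₀`),
`HubbardSymbolCentredComposition` (mixed lattice differences `Δ_{e_l}^aΔ_{e_{l'}}^b`, `a, b ≤ 2`, `l ≠ l'`, `8 < L`, of
`g(ω, u(c⃗))·κ(c⃗)` and of a band increment with a factor, sampled at the CENTRED momenta `c⃗(y)`), `HubbardUVGridPieceMomentOrders`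
(the first space moment of a padded piece from the `ℓ²` table at the orders `a ≤ 2`, `b ≤ 1`).  For the first space moments of the
scale-`0` multiplier kernels of Benfatto–Giuliani–Mastropietro 2006, §2.5 (2.45)–(2.48) (Lemma 2.2 (2.36aa); the band dependence
telescoped over the frame pieces as in §3 (3.2)–(3.8)) the two kinds of pieces are (i) the BARE piece `M_ℂ(ω, b(c⃗))·Ã(c⃗)` and
(ii) the INCREMENT `[M_ℂ(ω, v + w) − M_ℂ(ω, v)](c⃗)·Ã(c⃗)`; the angular factor `Ã` is any smooth real function with global bounds
(`ScaleZeroAngularFactorPeriodic.zoneAngularRaw`), the bands vanish off the shell near the zone boundary (`hvan`):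

* `multAmp B e₀ D W m k` — the amplitudes `e₀/2·(k+m)!·B·(2/e₀)^{k+m}·Σ_{j≤k} C(k,j)·j!·Dʲ·W_{k-j}`; `paddedPiece` — the padded grid
  function `[val q₀ < 2M]·(βL²)⁻²·Φ(ω̃_{q₀})(q⃗)` of a frequency-indexed family;
* **`multBasePiece_value_le`**, **`multBasePiece_step_le`**, **`multIncrPiece_value_le`**, **`multIncrPiece_step_le`** — the
  fibrewise hypotheses `(V)`, `(D)` of `HubbardUVGridPieceMoment` for the two kinds of pieces (`a, b ≤ 2`);
* **`spaceMoment_multBasePiece_le`**, **`spaceMoment_multIncrPiece_le`** —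
  `(β/N)·Σ_{a,b⃗} |b̃_l|·‖S[P](a,b⃗)‖ ≤ uvSpaceMomentConst (2e₀) R (uvPieceSq (2e₀) …)` (`2 ≤ β`, `β³ ≤ M`, `2M ≤ N`, `R ≥ 1`, `l ≠ l'`).

Everything is proved; `multAmp`, `paddedPiece` are the only definitions; no named facts.

## Sources

G. Benfatto, A. Giuliani, V. Mastropietro, Ann. Henri Poincaré 7 (2006) 809–898, §2.1 Lemma 2.2, (2.36aa), §2.5 (2.45)–(2.48),
§2.8 (2.80)–(2.81), §3 (3.2)–(3.8) (`BenfattoGiulianiMastropietro2006`).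
-/

noncomputable section

namespace Literature.MathematicalPhysics.QuantumLattice

open Literature.Probability.LatticeModels Literature.Analysis.Calculus Finset Complex Set
open scoped Nat

variable {L M N : ℕ}

/-! ### §1 Amplitudes and the padded piece -/

/-- The multiplier amplitudes `e₀/2·(k+m)!·B·(2/e₀)^{k+m}·Σ_{j≤k} C(k,j)·j!·Dʲ·W_{k-j}` (`m = 0`: value of the bare piece; `m = 1`: one
Matsubara step of the bare piece / value of an increment; `m = 2`: one step of an increment). [cite: BenfattoGiulianiMastropietro2006, (2.36aa)] -/
def multAmp (B e₀ D : ℝ) (W : ℕ → ℝ) (m k : ℕ) : ℝ :=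
  e₀ / 2 * ((k + m) ! * B * (2 / e₀) ^ (k + m)) * ∑ j ∈ Finset.range (k + 1), (k.choose j : ℝ) * j ! * D ^ j * W (k - j)

/-- **The padded grid piece** of a frequency-indexed lattice family: `P(q₀,q⃗) = [val q₀ < 2M]·(βL²)⁻²·Φ(ω̃_{q₀})(q⃗)`.
[cite: BenfattoGiulianiMastropietro2006, §2.5 (2.48)] -/
def paddedPiece (L M N : ℕ) (β : ℝ) (Φ : ℝ → TorusSite 2 L → ℂ) (q₀ : TorusSite 1 N) (qv : TorusSite 2 L) : ℂ :=
  if (q₀ 0).val < 2 * M then ((1 / (β * (L : ℝ) ^ 2) : ℝ) : ℂ) ^ 2 * Φ (gridFreq M N β q₀) qv else 0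

/-- Unfolding (the `hP` shape of `HubbardUVGridPieceMoment`). [cite: BenfattoGiulianiMastropietro2006, §2.5 (2.48)] -/
theorem paddedPiece_apply (β : ℝ) (Φ : ℝ → TorusSite 2 L → ℂ) (q₀ : TorusSite 1 N) (qv : TorusSite 2 L) :
    paddedPiece L M N β Φ q₀ qv =
      if (q₀ 0).val < 2 * M then ((1 / (β * (L : ℝ) ^ 2) : ℝ) : ℂ) ^ 2 * Φ (gridFreq M N β q₀) qv else 0 := rfl

/-- The padded piece is linear in the family: `P[Φ − Φ'] = P[Φ] − P[Φ']`. [cite: BenfattoGiulianiMastropietro2006, §3 (3.2)] -/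
theorem paddedPiece_sub (β : ℝ) (Φ Φ' : ℝ → TorusSite 2 L → ℂ) (q₀ : TorusSite 1 N) (qv : TorusSite 2 L) :
    paddedPiece L M N β (fun ω y => Φ ω y - Φ' ω y) q₀ qv = paddedPiece L M N β Φ q₀ qv - paddedPiece L M N β Φ' q₀ qv := by
  simp only [paddedPiece]
  split_ifs <;> ring

/-! ### §2 The shell hypothesis gives the vanishing near the zone boundary -/

section Vanish

variable {e₀ : ℝ}

/-- `‖(ω, e)‖ ≥ |e|` on the frequency–band plane. [cite: BenfattoGiulianiMastropietro2006, §2.2 (2.9)] -/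
theorem abs_le_norm_fbPt (ω e : ℝ) : |e| ≤ ‖fbPt ω e‖ := by
  have h := PiLp.norm_apply_le (fbPt ω e) 1
  rwa [fbPt_apply_one, Real.norm_eq_abs] at h

/-- Off the shell the complexified cutoff vanishes: `e₀ < |e| ⇒ M_ℂ(ω, e) = 0`. [cite: BenfattoGiulianiMastropietro2006, §2.2 (2.9)] -/
theorem bgmCutoffC_fbPt_eq_zero (he : 0 < e₀) (ω : ℝ) {e : ℝ} (h : e₀ < |e|) :
    ((bgmCutoff₂ e₀ (fbPt ω e) : ℝ) : ℂ) = 0 := by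
  rw [bgmCutoff₂_eq_zero_of_le he ((le_of_lt h).trans (abs_le_norm_fbPt ω e))]
  simp

/-- Off the shell the band derivative vanishes: `e₀ < |e| ⇒ ∂_v M_ℂ(ω, e) = 0`. [cite: BenfattoGiulianiMastropietro2006, §2.2 (2.9)] -/
theorem fbDir_bgmCutoffC_fbPt_eq_zero (he : 0 < e₀) (v : FreqBand) (ω : ℝ) {e : ℝ} (h : e₀ < |e|) :
    fbDir (fun x : FreqBand => ((bgmCutoff₂ e₀ x : ℝ) : ℂ)) v (fbPt ω e) = 0 := by
  have hx : e₀ < ‖fbPt ω e‖ := h.trans_le (abs_le_norm_fbPt ω e)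
  have h0 := iteratedFDeriv_fbDir_bgmCutoffC_eq_zero_of_gt he v hx 0
  have hn : ‖fbDir (fun x : FreqBand => ((bgmCutoff₂ e₀ x : ℝ) : ℂ)) v (fbPt ω e)‖ = 0 := by
    rw [← norm_iteratedFDeriv_zero (𝕜 := ℝ), h0, norm_zero]
  exact norm_eq_zero.1 hn

/-- The frequency translate also vanishes off the shell. [cite: BenfattoGiulianiMastropietro2006, §2.2 (2.9)] -/
theorem fbShiftSub_bgmCutoffC_fbPt_eq_zero (he : 0 < e₀) (δ ω : ℝ) {e : ℝ} (h : e₀ < |e|) :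
    fbShiftSub (fun x : FreqBand => ((bgmCutoff₂ e₀ x : ℝ) : ℂ)) δ (fbPt ω e) = 0 := by
  rw [fbShiftSub_fbPt, bgmCutoffC_fbPt_eq_zero he _ h, bgmCutoffC_fbPt_eq_zero he _ h, sub_zero]

/-- … and so does its band derivative. [cite: BenfattoGiulianiMastropietro2006, §2.2 (2.9)] -/
theorem fbDir_fbShiftSub_bgmCutoffC_fbPt_eq_zero (he : 0 < e₀) (δ ω : ℝ) {e : ℝ} (h : e₀ < |e|) :
    fbDir (fbShiftSub (fun x : FreqBand => ((bgmCutoff₂ e₀ x : ℝ) : ℂ)) δ) fbE1 (fbPt ω e) = 0 := by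
  have hdg : Differentiable ℝ (fun x : FreqBand => ((bgmCutoff₂ e₀ x : ℝ) : ℂ)) :=
    (contDiff_bgmCutoffC he (n := 1)).differentiable one_ne_zero
  rw [fbDir_fbShiftSub hdg, fbShiftSub_fbPt, fbDir_bgmCutoffC_fbPt_eq_zero he _ _ h, fbDir_bgmCutoffC_fbPt_eq_zero he _ _ h,
    sub_zero]

end Vanish

/-! ### §3 Fibrewise bounds of the bare piece `M_ℂ(ω, b(c⃗))·Ã(c⃗)` -/

section Base

variable [NeZero L] {β e₀ : ℝ} {Ncut : ℕ} {B : ℝ}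

/-- **(V) for the bare multiplier piece**: with `Φ(ω)(y) = βL²·M_ℂ(ω, b(c⃗(y)))·Ã(c⃗(y))`,
`‖Δ_{e_l}^aΔ_{e_{l'}}^b Φ(ω)(q⃗)‖ ≤ (2π/L)ᵏ·βL²·multAmp(0,k)·2/max(|ω|, e₀)` (`a, b ≤ 2`, `k = a + b ≤ 3 ≤ Ncut`).
[cite: BenfattoGiulianiMastropietro2006, (2.36aa)] -/
theorem multBasePiece_value_le (hβ : 0 < β) (he : 0 < e₀) (he2 : e₀ ≤ 2) (hL : 8 < L) (hB1 : 1 ≤ B)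
    (hB : ∀ i ≤ Ncut, ∀ u, ‖iteratedDeriv i (bgmCutoffSqUnit e₀) u‖ ≤ B) (hN : 5 ≤ Ncut)
    {bt A : EuclideanSpace ℝ (Fin 2) → ℝ} (hbt : ContDiff ℝ 3 bt) (hA : ContDiff ℝ 3 A)
    {D : ℝ} (hD : ∀ i, 1 ≤ i → i ≤ 3 → ∀ x, ‖iteratedFDeriv ℝ i bt x‖ ≤ D ^ i)
    {W : ℕ → ℝ} (hW : ∀ i ≤ 3, ∀ x, ‖iteratedFDeriv ℝ i A x‖ ≤ W i)
    (hvan : ∀ p : Fin 2 → ℝ, (∃ l : Fin 2, Real.cos (p l) ≤ -Real.cos (4 * Real.pi / L)) → e₀ < |bt (WithLp.toLp 2 p)|)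
    {a b : ℕ} (ha : a ≤ 2) (hb : b ≤ 2) (hab : a + b ≤ 3) {l l' : Fin 2} (hll' : l ≠ l') (ω : ℝ) (qv : TorusSite 2 L) :
    ‖(fwdDiff (Pi.single l (1 : ZMod L) : TorusSite 2 L))^[a] ((fwdDiff (Pi.single l' (1 : ZMod L) : TorusSite 2 L))^[b]
        (fun y => ((β * (L : ℝ) ^ 2 : ℝ) : ℂ) *
          (((bgmCutoff₂ e₀ (fbPt ω (bt (WithLp.toLp 2 (torusCentredMomentum L y)))) : ℝ) : ℂ) *
            ((A (WithLp.toLp 2 (torusCentredMomentum L y)) : ℝ) : ℂ)))) qv‖ ≤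
      (2 * Real.pi / L) ^ (a + b) * (β * (L : ℝ) ^ 2 * multAmp B e₀ D W 0 (a + b)) * (2 / max |ω| (2 * e₀ / 2)) := by
  have hG := fibreEnvBound_bgmCutoffC he he2 hB1 hB (k := a + b) (by omega)
  have h := norm_fwdDiff_iter₂_comp_mul_centred_le (L := L) (Λ := 2 * e₀) (by positivity) hL ha hb (contDiff_bgmCutoffC he) hG
    (hbt.of_le (by exact_mod_cast hab)) (hA.of_le (by exact_mod_cast hab)) (fun i hi1 hi3 x => hD i hi1 (hi3.trans hab) x)
    (fun i hi x => hW i (hi.trans hab) x) ω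
    (fun p hp => by rw [bgmCutoffC_fbPt_eq_zero he _ (hvan p hp), zero_mul]) hll' qv
  rw [fwdDiff_iter₂_const_mul, norm_mul, Complex.norm_real, Real.norm_of_nonneg (by positivity)]
  refine (mul_le_mul_of_nonneg_left h (by positivity)).trans (le_of_eq ?_)
  rw [sub_zero, multAmp]
  simp only [add_zero]
  ring

/-- **(D) for the bare multiplier piece** (one Matsubara step `δ = 2π/β`):
`‖Δ^aΔ^b Φ(ω+δ)(q⃗) − Δ^aΔ^b Φ(ω)(q⃗)‖ ≤ (2π/L)ᵏ·(2π/β)·βL²·multAmp(1,k)·2/max(|ω| − 2π/β, e₀)`.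
[cite: BenfattoGiulianiMastropietro2006, Lemma 2.2 and (2.36aa)] -/
theorem multBasePiece_step_le (hβ : 0 < β) (he : 0 < e₀) (he2 : e₀ ≤ 2) (hL : 8 < L) (hB1 : 1 ≤ B)
    (hB : ∀ i ≤ Ncut, ∀ u, ‖iteratedDeriv i (bgmCutoffSqUnit e₀) u‖ ≤ B) (hN : 5 ≤ Ncut)
    {bt A : EuclideanSpace ℝ (Fin 2) → ℝ} (hbt : ContDiff ℝ 3 bt) (hA : ContDiff ℝ 3 A)
    {D : ℝ} (hD : ∀ i, 1 ≤ i → i ≤ 3 → ∀ x, ‖iteratedFDeriv ℝ i bt x‖ ≤ D ^ i)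
    {W : ℕ → ℝ} (hW : ∀ i ≤ 3, ∀ x, ‖iteratedFDeriv ℝ i A x‖ ≤ W i)
    (hvan : ∀ p : Fin 2 → ℝ, (∃ l : Fin 2, Real.cos (p l) ≤ -Real.cos (4 * Real.pi / L)) → e₀ < |bt (WithLp.toLp 2 p)|)
    {a b : ℕ} (ha : a ≤ 2) (hb : b ≤ 2) (hab : a + b ≤ 3) {l l' : Fin 2} (hll' : l ≠ l') (ω : ℝ) (qv : TorusSite 2 L) :
    ‖(fwdDiff (Pi.single l (1 : ZMod L) : TorusSite 2 L))^[a] ((fwdDiff (Pi.single l' (1 : ZMod L) : TorusSite 2 L))^[b]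
          (fun y => ((β * (L : ℝ) ^ 2 : ℝ) : ℂ) *
            (((bgmCutoff₂ e₀ (fbPt (ω + 2 * Real.pi / β) (bt (WithLp.toLp 2 (torusCentredMomentum L y)))) : ℝ) : ℂ) *
              ((A (WithLp.toLp 2 (torusCentredMomentum L y)) : ℝ) : ℂ)))) qv -
        (fwdDiff (Pi.single l (1 : ZMod L) : TorusSite 2 L))^[a] ((fwdDiff (Pi.single l' (1 : ZMod L) : TorusSite 2 L))^[b]
          (fun y => ((β * (L : ℝ) ^ 2 : ℝ) : ℂ) *
            (((bgmCutoff₂ e₀ (fbPt ω (bt (WithLp.toLp 2 (torusCentredMomentum L y)))) : ℝ) : ℂ) *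
              ((A (WithLp.toLp 2 (torusCentredMomentum L y)) : ℝ) : ℂ)))) qv‖ ≤
      (2 * Real.pi / L) ^ (a + b) * (2 * Real.pi / β * (β * (L : ℝ) ^ 2 * multAmp B e₀ D W 1 (a + b))) *
        (2 / max (|ω| - 2 * Real.pi / β) (2 * e₀ / 2)) := by
  set δ : ℝ := 2 * Real.pi / β with hδ
  have hδ0 : 0 < δ := by positivity
  set g : FreqBand → ℂ := fun x => ((bgmCutoff₂ e₀ x : ℝ) : ℂ) with hg
  have hG := fibreEnvBound_fbShiftSub_bgmCutoffC he he2 hB1 hB (k := a + b) (by omega) δ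
  rw [abs_of_pos hδ0, ← hg] at hG
  set c : TorusSite 2 L → EuclideanSpace ℝ (Fin 2) := fun y => WithLp.toLp 2 (torusCentredMomentum L y) with hc
  have hfun : (fun y : TorusSite 2 L => ((β * (L : ℝ) ^ 2 : ℝ) : ℂ) * (g (fbPt (ω + δ) (bt (c y))) * ((A (c y) : ℝ) : ℂ))) -
      (fun y => ((β * (L : ℝ) ^ 2 : ℝ) : ℂ) * (g (fbPt ω (bt (c y))) * ((A (c y) : ℝ) : ℂ))) =
      fun y => ((β * (L : ℝ) ^ 2 : ℝ) : ℂ) * (fbShiftSub g δ (fbPt ω (bt (c y))) * ((A (c y) : ℝ) : ℂ)) := by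
    funext y; simp only [Pi.sub_apply, fbShiftSub_fbPt]; ring
  rw [← fwdDiff_iter₂_sub, hfun, fwdDiff_iter₂_const_mul, norm_mul, Complex.norm_real, Real.norm_of_nonneg (by positivity)]
  have h := norm_fwdDiff_iter₂_comp_mul_centred_le (L := L) (Λ := 2 * e₀) (by positivity) hL ha hb
    (contDiff_fbShiftSub (contDiff_bgmCutoffC he) δ) hG
    (hbt.of_le (by exact_mod_cast hab)) (hA.of_le (by exact_mod_cast hab)) (fun i hi1 hi3 x => hD i hi1 (hi3.trans hab) x)
    (fun i hi x => hW i (hi.trans hab) x) ω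
    (fun p hp => by rw [fbShiftSub_bgmCutoffC_fbPt_eq_zero he _ _ (hvan p hp), zero_mul]) hll' qv
  refine (mul_le_mul_of_nonneg_left h (by positivity)).trans (le_of_eq ?_)
  rw [multAmp]
  ring

end Base

/-! ### §4 Fibrewise bounds of an increment `[M_ℂ(ω, v + w) − M_ℂ(ω, v)](c⃗)·Ã(c⃗)` -/

section Incr

variable [NeZero L] {β e₀ : ℝ} {Ncut : ℕ} {B : ℝ}

/-- **(V) for a multiplier increment**: `‖Δ^aΔ^b[Φ_{v+w}(ω) − Φ_v(ω)](q⃗)‖ ≤ (2π/L)ᵏ·βL²·multAmp(1,k)·2/max(|ω|, e₀)`, where `W` bounds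
the derivatives of the product `w̃·Ã` and `D` those of `ṽ + s·w̃`, `s ∈ [0,1]` (`a, b ≤ 2`, `k = a + b ≤ 3`).
[cite: BenfattoGiulianiMastropietro2006, §3 (3.2)–(3.8)] -/
theorem multIncrPiece_value_le (hβ : 0 < β) (he : 0 < e₀) (he2 : e₀ ≤ 2) (hL : 8 < L) (hB1 : 1 ≤ B)
    (hB : ∀ i ≤ Ncut, ∀ u, ‖iteratedDeriv i (bgmCutoffSqUnit e₀) u‖ ≤ B) (hN : 5 ≤ Ncut)
    {vt wt A : EuclideanSpace ℝ (Fin 2) → ℝ} (hvt : ContDiff ℝ 3 vt) (hwt : ContDiff ℝ 3 wt) (hA : ContDiff ℝ 3 A)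
    {D : ℝ} (hD : ∀ s ∈ Icc (0 : ℝ) 1, ∀ i, 1 ≤ i → i ≤ 3 → ∀ x, ‖iteratedFDeriv ℝ i (fun x => vt x + s * wt x) x‖ ≤ D ^ i)
    {W : ℕ → ℝ} (hW : ∀ i ≤ 3, ∀ x, ‖iteratedFDeriv ℝ i (fun x => wt x * A x) x‖ ≤ W i)
    (hvan : ∀ s ∈ Icc (0 : ℝ) 1, ∀ p : Fin 2 → ℝ, (∃ l : Fin 2, Real.cos (p l) ≤ -Real.cos (4 * Real.pi / L)) →
      e₀ < |vt (WithLp.toLp 2 p) + s * wt (WithLp.toLp 2 p)|)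
    {a b : ℕ} (ha : a ≤ 2) (hb : b ≤ 2) (hab : a + b ≤ 3) {l l' : Fin 2} (hll' : l ≠ l') (ω : ℝ) (qv : TorusSite 2 L) :
    ‖(fwdDiff (Pi.single l (1 : ZMod L) : TorusSite 2 L))^[a] ((fwdDiff (Pi.single l' (1 : ZMod L) : TorusSite 2 L))^[b]
          (fun y => ((β * (L : ℝ) ^ 2 : ℝ) : ℂ) *
            (((bgmCutoff₂ e₀ (fbPt ω (vt (WithLp.toLp 2 (torusCentredMomentum L y)) +
                wt (WithLp.toLp 2 (torusCentredMomentum L y)))) : ℝ) : ℂ) *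
              ((A (WithLp.toLp 2 (torusCentredMomentum L y)) : ℝ) : ℂ)))) qv -
        (fwdDiff (Pi.single l (1 : ZMod L) : TorusSite 2 L))^[a] ((fwdDiff (Pi.single l' (1 : ZMod L) : TorusSite 2 L))^[b]
          (fun y => ((β * (L : ℝ) ^ 2 : ℝ) : ℂ) *
            (((bgmCutoff₂ e₀ (fbPt ω (vt (WithLp.toLp 2 (torusCentredMomentum L y)))) : ℝ) : ℂ) *
              ((A (WithLp.toLp 2 (torusCentredMomentum L y)) : ℝ) : ℂ)))) qv‖ ≤
      (2 * Real.pi / L) ^ (a + b) * (β * (L : ℝ) ^ 2 * multAmp B e₀ D W 1 (a + b)) * (2 / max |ω| (2 * e₀ / 2)) := by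
  set g : FreqBand → ℂ := fun x => ((bgmCutoff₂ e₀ x : ℝ) : ℂ) with hg
  have hG := fibreEnvBound_fbDir_bgmCutoffC he he2 hB1 hB (k := a + b) (by omega) fbE1
  rw [norm_fbE1, one_mul, ← hg] at hG
  rw [fwdDiff_iter₂_const_mul, fwdDiff_iter₂_const_mul, ← mul_sub, norm_mul, Complex.norm_real, Real.norm_of_nonneg (by positivity)]
  have hgc : ContDiff ℝ (((a + b : ℕ) : ℕ∞) + 1) g := contDiff_bgmCutoffC he
  have h := norm_fwdDiff_iter₂_increment_mul_centred_le (L := L) (Λ := 2 * e₀) (by positivity) hL ha hb hgc hG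
    (hvt.of_le (by exact_mod_cast hab)) (hwt.of_le (by exact_mod_cast hab)) (hA.of_le (by exact_mod_cast hab))
    (fun s hs i hi1 hi3 x => hD s hs i hi1 (hi3.trans hab) x) (fun i hi x => hW i (hi.trans hab) x) ω
    (fun s hs p hp => by rw [hg, fbDir_bgmCutoffC_fbPt_eq_zero he _ _ (hvan s (Ico_subset_Icc_self hs) p hp), zero_mul]) hll' qv
  refine (mul_le_mul_of_nonneg_left h (by positivity)).trans (le_of_eq ?_)
  rw [sub_zero, multAmp]
  ring

/-- **(D) for a multiplier increment** (one Matsubara step `δ = 2π/β`): the time-differenced increment is the increment of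
`M_ℂ(·+δe₀) − M_ℂ`, so `‖[Δ^aΔ^b Φ(ω+δ) − Δ^aΔ^b Φ(ω)](q⃗)‖ ≤ (2π/L)ᵏ·(2π/β)·βL²·multAmp(2,k)·2/max(|ω| − 2π/β, e₀)`.
[cite: BenfattoGiulianiMastropietro2006, Lemma 2.2 and §3 (3.2)–(3.8)] -/
theorem multIncrPiece_step_le (hβ : 0 < β) (he : 0 < e₀) (he2 : e₀ ≤ 2) (hL : 8 < L) (hB1 : 1 ≤ B)
    (hB : ∀ i ≤ Ncut, ∀ u, ‖iteratedDeriv i (bgmCutoffSqUnit e₀) u‖ ≤ B) (hN : 5 ≤ Ncut)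
    {vt wt A : EuclideanSpace ℝ (Fin 2) → ℝ} (hvt : ContDiff ℝ 3 vt) (hwt : ContDiff ℝ 3 wt) (hA : ContDiff ℝ 3 A)
    {D : ℝ} (hD : ∀ s ∈ Icc (0 : ℝ) 1, ∀ i, 1 ≤ i → i ≤ 3 → ∀ x, ‖iteratedFDeriv ℝ i (fun x => vt x + s * wt x) x‖ ≤ D ^ i)
    {W : ℕ → ℝ} (hW : ∀ i ≤ 3, ∀ x, ‖iteratedFDeriv ℝ i (fun x => wt x * A x) x‖ ≤ W i)
    (hvan : ∀ s ∈ Icc (0 : ℝ) 1, ∀ p : Fin 2 → ℝ, (∃ l : Fin 2, Real.cos (p l) ≤ -Real.cos (4 * Real.pi / L)) →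
      e₀ < |vt (WithLp.toLp 2 p) + s * wt (WithLp.toLp 2 p)|)
    {a b : ℕ} (ha : a ≤ 2) (hb : b ≤ 2) (hab : a + b ≤ 3) {l l' : Fin 2} (hll' : l ≠ l') (ω : ℝ) (qv : TorusSite 2 L) :
    ‖((fwdDiff (Pi.single l (1 : ZMod L) : TorusSite 2 L))^[a] ((fwdDiff (Pi.single l' (1 : ZMod L) : TorusSite 2 L))^[b]
          (fun y => ((β * (L : ℝ) ^ 2 : ℝ) : ℂ) *
            ((((bgmCutoff₂ e₀ (fbPt (ω + 2 * Real.pi / β) (vt (WithLp.toLp 2 (torusCentredMomentum L y)) +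
                wt (WithLp.toLp 2 (torusCentredMomentum L y)))) : ℝ) : ℂ) -
              (((bgmCutoff₂ e₀ (fbPt (ω + 2 * Real.pi / β) (vt (WithLp.toLp 2 (torusCentredMomentum L y))))) : ℝ) : ℂ)) *
              ((A (WithLp.toLp 2 (torusCentredMomentum L y)) : ℝ) : ℂ)))) qv -
        (fwdDiff (Pi.single l (1 : ZMod L) : TorusSite 2 L))^[a] ((fwdDiff (Pi.single l' (1 : ZMod L) : TorusSite 2 L))^[b]
          (fun y => ((β * (L : ℝ) ^ 2 : ℝ) : ℂ) *
            ((((bgmCutoff₂ e₀ (fbPt ω (vt (WithLp.toLp 2 (torusCentredMomentum L y)) +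
                wt (WithLp.toLp 2 (torusCentredMomentum L y)))) : ℝ) : ℂ) -
              (((bgmCutoff₂ e₀ (fbPt ω (vt (WithLp.toLp 2 (torusCentredMomentum L y))))) : ℝ) : ℂ)) *
              ((A (WithLp.toLp 2 (torusCentredMomentum L y)) : ℝ) : ℂ)))) qv)‖ ≤
      (2 * Real.pi / L) ^ (a + b) * (2 * Real.pi / β * (β * (L : ℝ) ^ 2 * multAmp B e₀ D W 2 (a + b))) *
        (2 / max (|ω| - 2 * Real.pi / β) (2 * e₀ / 2)) := by
  set δ : ℝ := 2 * Real.pi / β with hδ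
  have hδ0 : 0 < δ := by positivity
  set g : FreqBand → ℂ := fun x => ((bgmCutoff₂ e₀ x : ℝ) : ℂ) with hg
  set g' := fbShiftSub g δ with hg'
  have hG := fibreEnvBound_fbDir_fbShiftSub_bgmCutoffC he he2 hB1 hB (k := a + b) (by omega) δ fbE1
  rw [norm_fbE1, mul_one, abs_of_pos hδ0, ← hg, ← hg'] at hG
  set c : TorusSite 2 L → EuclideanSpace ℝ (Fin 2) := fun y => WithLp.toLp 2 (torusCentredMomentum L y) with hc
  -- the time-differenced increment is the increment of `g' = g(·+δe₀) − g`, times the factor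
  have hfun : ((fun y : TorusSite 2 L => ((β * (L : ℝ) ^ 2 : ℝ) : ℂ) *
      ((g (fbPt (ω + δ) (vt (c y) + wt (c y))) - g (fbPt (ω + δ) (vt (c y)))) * ((A (c y) : ℝ) : ℂ))) -
      fun y => ((β * (L : ℝ) ^ 2 : ℝ) : ℂ) * ((g (fbPt ω (vt (c y) + wt (c y))) - g (fbPt ω (vt (c y)))) * ((A (c y) : ℝ) : ℂ))) =
      fun y => ((β * (L : ℝ) ^ 2 : ℝ) : ℂ) *
        (g' (fbPt ω (vt (c y) + wt (c y))) * ((A (c y) : ℝ) : ℂ) - g' (fbPt ω (vt (c y))) * ((A (c y) : ℝ) : ℂ)) := by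
    funext y; simp only [Pi.sub_apply, hg', fbShiftSub_fbPt]; ring
  rw [← fwdDiff_iter₂_sub, hfun, fwdDiff_iter₂_const_mul, norm_mul, Complex.norm_real, Real.norm_of_nonneg (by positivity),
    show (fun y : TorusSite 2 L => g' (fbPt ω (vt (c y) + wt (c y))) * ((A (c y) : ℝ) : ℂ) - g' (fbPt ω (vt (c y))) * ((A (c y) : ℝ) : ℂ)) =
      (fun y => g' (fbPt ω (vt (c y) + wt (c y))) * ((A (c y) : ℝ) : ℂ)) - fun y => g' (fbPt ω (vt (c y))) * ((A (c y) : ℝ) : ℂ)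
      from rfl, fwdDiff_iter₂_sub]
  have hgc : ContDiff ℝ (((a + b : ℕ) : ℕ∞) + 1) g' := contDiff_fbShiftSub (contDiff_bgmCutoffC he) δ
  have h := norm_fwdDiff_iter₂_increment_mul_centred_le (L := L) (Λ := 2 * e₀) (by positivity) hL ha hb hgc hG
    (hvt.of_le (by exact_mod_cast hab)) (hwt.of_le (by exact_mod_cast hab)) (hA.of_le (by exact_mod_cast hab))
    (fun s hs i hi1 hi3 x => hD s hs i hi1 (hi3.trans hab) x) (fun i hi x => hW i (hi.trans hab) x) ω
    (fun s hs p hp => by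
      rw [hg', hg, fbDir_fbShiftSub_bgmCutoffC_fbPt_eq_zero he _ _ (hvan s (Ico_subset_Icc_self hs) p hp), zero_mul]) hll' qv
  refine (mul_le_mul_of_nonneg_left h (by positivity)).trans (le_of_eq ?_)
  rw [multAmp]
  ring

end Incr

/-! ### §5 The first space moments of the two kinds of pieces -/

section Moments

variable [NeZero L] [NeZero N] {β e₀ : ℝ} {Ncut : ℕ} {B : ℝ}

/-- The two rows `t = 0, 1` of the restricted compact table from the `(V)` / `(D)` rows. [cite: BenfattoGiulianiMastropietro2006, (2.36aa)] -/
theorem compactTable_of_rows_orders (P : TorusSite 1 N → TorusSite 2 L → ℂ) (Kq : ℕ → ℕ → ℝ) (l l' : Fin 2)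
    (h0 : ∀ a b : ℕ, 1 ≤ a + b → a ≤ 2 → b ≤ 1 →
      ∑ p : TorusSite 1 N, ∑ p' : TorusSite 2 L,
          ‖(fwdDiff (Pi.single l (1 : ZMod L) : TorusSite 2 L))^[a]
            ((fwdDiff (Pi.single l' (1 : ZMod L) : TorusSite 2 L))^[b] (P p)) p'‖ ^ 2 ≤
        Kq 0 (a + b) / ((L : ℝ) ^ (2 * (a + b) + 2) * β ^ (2 * 0 + 1)))
    (h1 : ∀ a b : ℕ, 1 ≤ a + b → a ≤ 2 → b ≤ 1 →
      ∑ p : TorusSite 1 N, ∑ p' : TorusSite 2 L,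
          ‖(fwdDiff (fun _ : Fin 1 => (1 : ZMod N)))^[1]
            (fun q => (fwdDiff (Pi.single l (1 : ZMod L) : TorusSite 2 L))^[a]
              ((fwdDiff (Pi.single l' (1 : ZMod L) : TorusSite 2 L))^[b] (P q)) p') p‖ ^ 2 ≤
        Kq 1 (a + b) / ((L : ℝ) ^ (2 * (a + b) + 2) * β ^ (2 * 1 + 1))) :
    ∀ (t a b : ℕ), t ≤ 1 → 1 ≤ a + b → a ≤ 2 → b ≤ 1 →
      ∑ p : TorusSite 1 N, ∑ p' : TorusSite 2 L,
          ‖(fwdDiff (fun _ : Fin 1 => (1 : ZMod N)))^[t]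
            (fun q => (fwdDiff (Pi.single l (1 : ZMod L) : TorusSite 2 L))^[a]
              ((fwdDiff (Pi.single l' (1 : ZMod L) : TorusSite 2 L))^[b] (P q)) p') p‖ ^ 2 ≤
        Kq t (a + b) / ((L : ℝ) ^ (2 * (a + b) + 2) * β ^ (2 * t + 1)) := by
  intro t a b ht hab1 ha hb
  interval_cases t
  · simpa only [Function.iterate_zero, id_eq] using h0 a b hab1 ha hb
  · exact h1 a b hab1 ha hb

/-- **The first space moment of the BARE multiplier piece** `P = paddedPiece L M N β Φ`, `Φ(ω)(y) = βL²·M_ℂ(ω, b(c⃗(y)))·Ã(c⃗(y))`: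
`(β/N)·Σ_{a,b⃗} |b̃_l|·‖S[P](a,b⃗)‖ ≤ uvSpaceMomentConst (2e₀) R (uvPieceSq (2e₀) (multAmp B e₀ D W 0) (multAmp B e₀ D W 1))`.
[cite: BenfattoGiulianiMastropietro2006, §2.8 (2.80)–(2.81) and §2.5 (2.48)] -/
theorem spaceMoment_multBasePiece_le (hβ2 : 2 ≤ β) (he : 0 < e₀) (he2 : e₀ ≤ 2) (hL : 8 < L) (hβM : β ^ 3 ≤ (M : ℝ))
    (hMN : 2 * M ≤ N) (hB1 : 1 ≤ B) (hB : ∀ i ≤ Ncut, ∀ u, ‖iteratedDeriv i (bgmCutoffSqUnit e₀) u‖ ≤ B) (hN : 5 ≤ Ncut)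
    {bt A : EuclideanSpace ℝ (Fin 2) → ℝ} (hbt : ContDiff ℝ 3 bt) (hA : ContDiff ℝ 3 A)
    {D : ℝ} (hD : ∀ i, 1 ≤ i → i ≤ 3 → ∀ x, ‖iteratedFDeriv ℝ i bt x‖ ≤ D ^ i)
    {W : ℕ → ℝ} (hW : ∀ i ≤ 3, ∀ x, ‖iteratedFDeriv ℝ i A x‖ ≤ W i)
    (hvan : ∀ p : Fin 2 → ℝ, (∃ l : Fin 2, Real.cos (p l) ≤ -Real.cos (4 * Real.pi / L)) → e₀ < |bt (WithLp.toLp 2 p)|)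
    {l l' : Fin 2} (hll' : l ≠ l') {R : ℕ} (hR : 1 ≤ R) :
    β / N * ∑ a : TorusSite 1 N, ∑ bv : TorusSite 2 L,
        |(((bv l).valMinAbs : ℤ) : ℝ)| *
          ‖∑ q₀ : TorusSite 1 N, ∑ qv : TorusSite 2 L, torusChar q₀ a * torusChar qv bv *
            paddedPiece L M N β (fun ω y => ((β * (L : ℝ) ^ 2 : ℝ) : ℂ) *
              (((bgmCutoff₂ e₀ (fbPt ω (bt (WithLp.toLp 2 (torusCentredMomentum L y)))) : ℝ) : ℂ) *
                ((A (WithLp.toLp 2 (torusCentredMomentum L y)) : ℝ) : ℂ))) q₀ qv‖ ≤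
      uvSpaceMomentConst (2 * e₀) R (uvPieceSq (2 * e₀) (multAmp B e₀ D W 0) (multAmp B e₀ D W 1)) := by
  obtain ⟨hβ, hM1, h8, hMN'⟩ := thresholds_aux hβ2 hβM hMN
  have hΛ : 0 < 2 * e₀ := by positivity
  set Φ : ℝ → TorusSite 2 L → ℂ := fun ω y => ((β * (L : ℝ) ^ 2 : ℝ) : ℂ) *
    (((bgmCutoff₂ e₀ (fbPt ω (bt (WithLp.toLp 2 (torusCentredMomentum L y)))) : ℝ) : ℂ) *
      ((A (WithLp.toLp 2 (torusCentredMomentum L y)) : ℝ) : ℂ)) with hΦ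
  set P := paddedPiece L M N β Φ with hPdef
  have hP : ∀ q₀ qv, P q₀ qv = if (q₀ 0).val < 2 * M then ((1 / (β * (L : ℝ) ^ 2) : ℝ) : ℂ) ^ 2 * Φ (gridFreq M N β q₀) qv else 0 :=
    fun q₀ qv => rfl
  refine spaceMoment_charSum_piece_le_of_orders hβ2 hΛ hβM hMN P _ (uvPieceSq_nonneg hΛ _ _) hll' ?_ hR
  refine compactTable_of_rows_orders P _ l l' (fun a b _ ha hb => ?_) (fun a b _ ha hb => ?_)
  · exact sum_norm_sq_spaceDiff_piece_le hβ hΛ hMN Φ P hP _ _ _ _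
      (fun ω qv => multBasePiece_value_le (L := L) hβ he he2 hL hB1 hB hN hbt hA hD hW hvan ha (by omega) (by omega) hll' ω qv)
  · exact sum_norm_sq_timeDiff_spaceDiff_piece_le hβ2 hΛ hβM hMN Φ P hP _ _ _ _
      (fun ω qv => multBasePiece_value_le (L := L) hβ he he2 hL hB1 hB hN hbt hA hD hW hvan ha (by omega) (by omega) hll' ω qv)
      (fun ω qv => multBasePiece_step_le (L := L) hβ he he2 hL hB1 hB hN hbt hA hD hW hvan ha (by omega) (by omega) hll' ω qv)

/-- **The first space moment of a multiplier INCREMENT** `P = paddedPiece L M N β (Φ_{v+w} − Φ_v)`: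
`(β/N)·Σ_{a,b⃗} |b̃_l|·‖S[P](a,b⃗)‖ ≤ uvSpaceMomentConst (2e₀) R (uvPieceSq (2e₀) (multAmp B e₀ D W 1) (multAmp B e₀ D W 2))` (`W` bounds
the derivatives of `w̃·Ã`). [cite: BenfattoGiulianiMastropietro2006, §2.8 (2.80)–(2.81) and §3 (3.2)–(3.8)] -/
theorem spaceMoment_multIncrPiece_le (hβ2 : 2 ≤ β) (he : 0 < e₀) (he2 : e₀ ≤ 2) (hL : 8 < L) (hβM : β ^ 3 ≤ (M : ℝ))
    (hMN : 2 * M ≤ N) (hB1 : 1 ≤ B) (hB : ∀ i ≤ Ncut, ∀ u, ‖iteratedDeriv i (bgmCutoffSqUnit e₀) u‖ ≤ B) (hN : 5 ≤ Ncut)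
    {vt wt A : EuclideanSpace ℝ (Fin 2) → ℝ} (hvt : ContDiff ℝ 3 vt) (hwt : ContDiff ℝ 3 wt) (hA : ContDiff ℝ 3 A)
    {D : ℝ} (hD : ∀ s ∈ Icc (0 : ℝ) 1, ∀ i, 1 ≤ i → i ≤ 3 → ∀ x, ‖iteratedFDeriv ℝ i (fun x => vt x + s * wt x) x‖ ≤ D ^ i)
    {W : ℕ → ℝ} (hW : ∀ i ≤ 3, ∀ x, ‖iteratedFDeriv ℝ i (fun x => wt x * A x) x‖ ≤ W i)
    (hvan : ∀ s ∈ Icc (0 : ℝ) 1, ∀ p : Fin 2 → ℝ, (∃ l : Fin 2, Real.cos (p l) ≤ -Real.cos (4 * Real.pi / L)) →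
      e₀ < |vt (WithLp.toLp 2 p) + s * wt (WithLp.toLp 2 p)|)
    {l l' : Fin 2} (hll' : l ≠ l') {R : ℕ} (hR : 1 ≤ R) :
    β / N * ∑ a : TorusSite 1 N, ∑ bv : TorusSite 2 L,
        |(((bv l).valMinAbs : ℤ) : ℝ)| *
          ‖∑ q₀ : TorusSite 1 N, ∑ qv : TorusSite 2 L, torusChar q₀ a * torusChar qv bv *
            paddedPiece L M N β (fun ω y => ((β * (L : ℝ) ^ 2 : ℝ) : ℂ) *
              ((((bgmCutoff₂ e₀ (fbPt ω (vt (WithLp.toLp 2 (torusCentredMomentum L y)) +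
                  wt (WithLp.toLp 2 (torusCentredMomentum L y)))) : ℝ) : ℂ) -
                (((bgmCutoff₂ e₀ (fbPt ω (vt (WithLp.toLp 2 (torusCentredMomentum L y))))) : ℝ) : ℂ)) *
                ((A (WithLp.toLp 2 (torusCentredMomentum L y)) : ℝ) : ℂ))) q₀ qv‖ ≤
      uvSpaceMomentConst (2 * e₀) R (uvPieceSq (2 * e₀) (multAmp B e₀ D W 1) (multAmp B e₀ D W 2)) := by
  obtain ⟨hβ, hM1, h8, hMN'⟩ := thresholds_aux hβ2 hβM hMN
  have hΛ : 0 < 2 * e₀ := by positivity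
  set c : TorusSite 2 L → EuclideanSpace ℝ (Fin 2) := fun y => WithLp.toLp 2 (torusCentredMomentum L y) with hc
  set Φ : ℝ → TorusSite 2 L → ℂ := fun ω y => ((β * (L : ℝ) ^ 2 : ℝ) : ℂ) *
    ((((bgmCutoff₂ e₀ (fbPt ω (vt (c y) + wt (c y))) : ℝ) : ℂ) - (((bgmCutoff₂ e₀ (fbPt ω (vt (c y)))) : ℝ) : ℂ)) *
      ((A (c y) : ℝ) : ℂ)) with hΦ
  set P := paddedPiece L M N β Φ with hPdef
  have hP : ∀ q₀ qv, P q₀ qv = if (q₀ 0).val < 2 * M then ((1 / (β * (L : ℝ) ^ 2) : ℝ) : ℂ) ^ 2 * Φ (gridFreq M N β q₀) qv else 0 :=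
    fun q₀ qv => rfl
  -- the space differences of `Φ(ω)` are differences of those of the two composed symbols
  have hsplit : ∀ ω, Φ ω = (fun y => ((β * (L : ℝ) ^ 2 : ℝ) : ℂ) * ((((bgmCutoff₂ e₀ (fbPt ω (vt (c y) + wt (c y)))) : ℝ) : ℂ) *
      ((A (c y) : ℝ) : ℂ))) - fun y => ((β * (L : ℝ) ^ 2 : ℝ) : ℂ) * ((((bgmCutoff₂ e₀ (fbPt ω (vt (c y)))) : ℝ) : ℂ) *
        ((A (c y) : ℝ) : ℂ)) := by
    intro ω; funext y; simp only [hΦ, Pi.sub_apply]; ring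
  have hsub : ∀ (a b : ℕ) (ω : ℝ) (qv : TorusSite 2 L),
      (fwdDiff (Pi.single l (1 : ZMod L) : TorusSite 2 L))^[a] ((fwdDiff (Pi.single l' (1 : ZMod L) : TorusSite 2 L))^[b] (Φ ω)) qv =
        (fwdDiff (Pi.single l (1 : ZMod L) : TorusSite 2 L))^[a] ((fwdDiff (Pi.single l' (1 : ZMod L) : TorusSite 2 L))^[b]
            (fun y => ((β * (L : ℝ) ^ 2 : ℝ) : ℂ) * ((((bgmCutoff₂ e₀ (fbPt ω (vt (c y) + wt (c y)))) : ℝ) : ℂ) *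
              ((A (c y) : ℝ) : ℂ)))) qv -
          (fwdDiff (Pi.single l (1 : ZMod L) : TorusSite 2 L))^[a] ((fwdDiff (Pi.single l' (1 : ZMod L) : TorusSite 2 L))^[b]
            (fun y => ((β * (L : ℝ) ^ 2 : ℝ) : ℂ) * ((((bgmCutoff₂ e₀ (fbPt ω (vt (c y)))) : ℝ) : ℂ) * ((A (c y) : ℝ) : ℂ)))) qv := by
    intro a b ω qv
    rw [hsplit ω, fwdDiff_iter₂_sub]
  have hstep : ∀ (a b : ℕ) (ω : ℝ) (qv : TorusSite 2 L),
      (fwdDiff (Pi.single l (1 : ZMod L) : TorusSite 2 L))^[a] ((fwdDiff (Pi.single l' (1 : ZMod L) : TorusSite 2 L))^[b]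
          (Φ (ω + 2 * Real.pi / β))) qv -
        (fwdDiff (Pi.single l (1 : ZMod L) : TorusSite 2 L))^[a] ((fwdDiff (Pi.single l' (1 : ZMod L) : TorusSite 2 L))^[b] (Φ ω)) qv =
        (fwdDiff (Pi.single l (1 : ZMod L) : TorusSite 2 L))^[a] ((fwdDiff (Pi.single l' (1 : ZMod L) : TorusSite 2 L))^[b]
            (fun y => ((β * (L : ℝ) ^ 2 : ℝ) : ℂ) *
              ((((bgmCutoff₂ e₀ (fbPt (ω + 2 * Real.pi / β) (vt (c y) + wt (c y))) : ℝ) : ℂ) -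
                (((bgmCutoff₂ e₀ (fbPt (ω + 2 * Real.pi / β) (vt (c y)))) : ℝ) : ℂ)) * ((A (c y) : ℝ) : ℂ)))) qv -
          (fwdDiff (Pi.single l (1 : ZMod L) : TorusSite 2 L))^[a] ((fwdDiff (Pi.single l' (1 : ZMod L) : TorusSite 2 L))^[b]
            (fun y => ((β * (L : ℝ) ^ 2 : ℝ) : ℂ) *
              ((((bgmCutoff₂ e₀ (fbPt ω (vt (c y) + wt (c y))) : ℝ) : ℂ) - (((bgmCutoff₂ e₀ (fbPt ω (vt (c y)))) : ℝ) : ℂ)) *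
                ((A (c y) : ℝ) : ℂ)))) qv := fun a b ω qv => rfl
  refine spaceMoment_charSum_piece_le_of_orders hβ2 hΛ hβM hMN P _ (uvPieceSq_nonneg hΛ _ _) hll' ?_ hR
  refine compactTable_of_rows_orders P _ l l' (fun a b _ ha hb => ?_) (fun a b _ ha hb => ?_)
  · exact sum_norm_sq_spaceDiff_piece_le hβ hΛ hMN Φ P hP _ _ _ _
      (fun ω qv => by
        rw [hsub]
        exact multIncrPiece_value_le (L := L) hβ he he2 hL hB1 hB hN hvt hwt hA hD hW hvan ha (by omega) (by omega) hll' ω qv)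
  · exact sum_norm_sq_timeDiff_spaceDiff_piece_le hβ2 hΛ hβM hMN Φ P hP _ _ _ _
      (fun ω qv => by
        rw [hsub]
        exact multIncrPiece_value_le (L := L) hβ he he2 hL hB1 hB hN hvt hwt hA hD hW hvan ha (by omega) (by omega) hll' ω qv)
      (fun ω qv => by
        rw [hstep]
        exact multIncrPiece_step_le (L := L) hβ he he2 hL hB1 hB hN hvt hwt hA hD hW hvan ha (by omega) (by omega) hll' ω qv)

end Moments

end Literature.MathematicalPhysics.QuantumLattice
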